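import Summits.AtomisticToContinuum.BoseEinsteinCondensation.Theorems.BECThomsonPrincipleFibreConductanceConditionalDefs
import Summits.AtomisticToContinuum.BoseEinsteinCondensation.Theorems.BECThomsonPrincipleFibreConductanceStubBottomMode
import HarnessLib

/-!
# Route `BECThomsonPrinciple`, crux `FibreConductance` (stmt-AtomisticToContinuum-9480):
# the STRATEGIST'S SPLIT  `LocalFibreConductance → CoarseBeatConductance → HalfShellOccupation → FibreConductance`

Crux-strategist decomposition (unit `cstrat-stmt-AtomisticToContinuum-9480-p1`, wall-breaker on the
exhausted chain; STRATEGY-CENSUS.md §Decomposition D1).  The crux is the bath-averaged weighted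
`H⁻¹(ψ²dy; W dX̂)` bound of the fibre charge `q = L^{-3/2}(e_nψ − βψ²)` (dual form `CruxDualBound`,
`fibreConductance_iff_cruxDualBound`, p104461/DualBridge).  Every registered line died at the same two
stubs: a LANDSCAPE input typed through uniform-location hole moments (`ConditionalDensityMoments`,
summit-strength: `CondensateFloor.condensation_of_conditionalDensityMoments`, p125262) and the INFRARED
occupation input `ShellOccupation`, whose necessity is a theorem (`infraredNecessity` p90785,
`singleModeOccupation_of_fibreConductance` p126624).  The split below types the three contents apart,
on the wavelength tiling of the line `conditional-law-poincare` (`‖n‖_∞³` cubes of side `L/‖n‖_∞`,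
charge `q = q_loc + q_c`, `q_c = ψ²·c_Q/μ_Q` the `μ`-proportional block part):

* `LocalFibreConductance` (child 1, LANDSCAPE, local): the pairing of the LOCAL part,
  `‖∫qη − ∫q_cη‖² ≤ (A L²/‖n‖²)·E(η)` for every test `η` (`E(η) = ∫|∇₀η|²ψ²/W`).  Written as a
  DIFFERENCE of the two Bochner pairings so that no integrability of the piecewise block charge is
  part of the statement.  Pure landscape: per fibre it is bounded by `4 ×` the cube-averaged weighted
  Poincaré constant of the conditional law `ψ²(·|X̂)dy` on the wavelength cubes (no occupation number
  enters: `∫_Q|q_loc|²/ψ² ≤ 4L⁻³|Q|` deterministically); it HOLDS in the fully localised no-BEC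
  scenario (cost `≍ ξ²`), so it is not BEC-strength; only cages INSIDE a wavelength cube are charged.
* `CoarseBeatConductance` (child 2, LANDSCAPE-coarse, CONDITIONAL on child 3): the half-shell
  occupation input implies the dual bound of the COARSE part, `‖∫q_cη‖² ≤ (B L²/‖n‖²)·E(η)` for
  `‖n‖_∞ ≥ 2` — a random-conductance LATTICE `H⁻¹` bound for the neutral cube charges `c_Q` on the
  `‖n‖_∞³` grid (flat part = the aliased beat sum `Σ_P s_P² n_{P−n}/(N|k_P|²)` paid by the input and
  `Σ n_p = N`; conductances = coarse cages at scale `ℓ`; density-fluctuation term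
  `|ĉ_{−n}|²·Var(L³μ_Q/|Q|)`).  `q_c ≡ 0` at `v = 0`, at `‖n‖_∞ = 1` and in the localised scenario.
* `HalfShellOccupation` (child 3, INFRARED): VERBATIM the landed `ParsevalShellBootstrap.ShellOccupation`
  (`Theorems/BECThomsonPrincipleDefs.lean`; drefuted, survived; guards pinned p75961/p77197) — the
  per-mode occupation bound `n_p(|Φ|) ≤ KN/(‖n‖²p₁)` on the resonant half-shell for exact ground states,
  the crux's thermodynamic-limit content (necessity p90785).  Its only known source is the route's own
  rank-2 crux `GaussianDominationCan` via the `T = 0` KLS step at exact minimisers (census §0, §Strengthen S5).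

Glue (this file, sorry-free, std axioms): `fibreConductance_of_subs : LocalFibreConductance →
CoarseBeatConductance → HalfShellOccupation → FibreConductance`, with the children defined here (§A,
namespace `…StrategistSplit.Children`, same short names) by the SAME bodies that `route edit --split … --into
children.json` installs in the route file, so that a prover re-lands the implication against the gate-written
decls by defeq (Summits/Theorems is prover-only; this file is attached as evidence on stmt-9480).  Proof: `‖∫qη‖² ≤ 2‖∫qη − ∫q_cη‖² + 2‖∫q_cη‖²`; at
`‖n‖_∞ = 1` the block charge vanishes identically (`bottomMode_neutral`, p108117, +
`coarseOf_cruxCharge_zero_eq_zero`); realisation by the landed Thomson half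
`fibreConductance_of_cruxDualBound` (`stub_thomson`, p103256).  R. Lyons, Y. Peres, *Probability on
Trees and Networks* (2016) Ch. 2 §2.4 (Thomson's principle); T. Kennedy, E. H. Lieb, B. S. Shastry,
J. Stat. Phys. 53 (1988) 1019. [folklore]
-/

noncomputable section

/-! ## §A  The three children, stated over the ROUTE FILE's vocabulary only
(`Mathlib` + `Literature.MathematicalPhysics.QuantumManyBody.PeriodicBoseGas{,FracEnergy}`), word for word
the `statement` fields of `children.json` (route-environment probe: `RouteEnvProbe.lean`, evidence). -/

namespace Summit.AtomisticToContinuum.BoseEinsteinCondensation.Cruxes.FibreConductance.StrategistSplit.Children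

/-! The three children carry here EXACTLY the decl names and bodies the split installs in the route file
(`Theses.BECThomsonPrinciple.{HalfShellOccupation, LocalFibreConductance, CoarseBeatConductance}`), but live in
the namespace `…Cruxes.FibreConductance.StrategistSplit.Children` so that this module keeps compiling after the
gate has written the route-file decls (no duplicate declarations); the prover's Theorems file then proves
`Theses.….LocalFibreConductance → … → FibreConductance` by `StrategistSplit.fibreConductance_of_subs` (defeq,
identical bodies) or by `fibreConductance_of_named` with the `Iff.rfl` casts of §B. -/

/-- Child 3 (INFRARED input; = `ParsevalShellBootstrap.ShellOccupation` verbatim). -/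
def HalfShellOccupation : Prop :=
  ∀ v : ℝ → ENNReal, Literature.MathematicalPhysics.QuantumManyBody.BoseGas.IsRepulsiveFiniteRange v → (∃ B : ℝ, ∀ r, v r ≤ ENNReal.ofReal B) → ∀ M : ℝ, 0 < M → ∃ θ ρ₀ K : ℝ, 0 < θ ∧ 0 < ρ₀ ∧ 0 < K ∧ ∃ N₀ : ℕ, ∀ m : ℕ, N₀ ≤ m + 1 → ∀ L : ℝ, 0 < L → ((m + 1 : ℕ) : ℝ) ≤ ρ₀ * L ^ 3 → ∀ n : Fin 3 → ℤ, n ≠ 0 → 2 * Real.pi * ‖(fun j => (n j : ℝ))‖ / L ≤ M * Real.sqrt ((m + 1 : ℕ) / L ^ 3) → ∀ Φ : Literature.MathematicalPhysics.QuantumManyBody.BoseGas.PeriodicTrialState (m + 1) L, Literature.MathematicalPhysics.QuantumManyBody.BoseGas.periodicEnergy v Φ = Literature.MathematicalPhysics.QuantumManyBody.BoseGas.periodicGroundStateEnergy v (m + 1) L → (∀ X, Φ.ψ X ≠ 0) → ∀ p₁ : ℝ, 0 < p₁ → p₁ ≤ θ * Real.sqrt ((m + 1 : ℕ) / L ^ 3)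 * L / (2 * Real.pi) → p₁ ≤ ‖(fun j => (n j : ℝ))‖ / 2 → ∀ p : Fin 3 → ℤ, ‖(fun j => ((p j + n j : ℤ) : ℝ))‖ < p₁ → Literature.MathematicalPhysics.QuantumManyBody.BoseGas.cellOccupation (m + 1) L (Literature.MathematicalPhysics.QuantumManyBody.BoseGas.planeWaveMode L p) (fun X => (‖Φ.ψ X‖ : ℂ)) ≤ ENNReal.ofReal (K * (m + 1 : ℕ) / (‖(fun j => (n j : ℝ))‖ ^ 2 * p₁))

/-- Child 1 (LANDSCAPE, local): the local part of the fibre charge on the wavelength tiling has fibre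
dual bound `A L²/‖n‖²` (difference-of-pairings form). -/
def LocalFibreConductance : Prop :=
  ∀ v : ℝ → ENNReal, Literature.MathematicalPhysics.QuantumManyBody.BoseGas.IsRepulsiveFiniteRange v → (∃ B : ℝ, ∀ r, v r ≤ ENNReal.ofReal B) → ∀ M : ℝ, 0 < M → ∃ ρ₀ A : ℝ, 0 < ρ₀ ∧ 0 < A ∧ ∃ N₀ : ℕ, ∀ m : ℕ, N₀ ≤ m + 1 → ∀ L : ℝ, 0 < L → ((m + 1 : ℕ) : ℝ) ≤ ρ₀ * L ^ 3 → ∀ n : Fin 3 → ℤ, n ≠ 0 → 2 * Real.pi * ‖(fun j => (n j : ℝ))‖ / L ≤ M * Real.sqrt ((m + 1 : ℕ) / L ^ 3) → ∀ Φ : Literature.MathematicalPhysics.QuantumManyBody.BoseGas.PeriodicTrialState (m + 1) L, Literature.MathematicalPhysics.QuantumManyBody.BoseGas.periodicEnergy v Φ = Literature.MathematicalPhysics.QuantumManyBody.BoseGas.periodicGroundStateEnergy v (m + 1) L → (∀ X, Φ.ψ X ≠ 0) → let W : Literature.MathematicalPhysics.QuantumManyBody.BoseGas.Config (m + 1) →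 ℝ := fun X => ∫ y in Literature.MathematicalPhysics.QuantumManyBody.BoseGas.cell L, ‖Φ.ψ (Function.update X 0 y)‖ ^ 2; let ψ : Literature.MathematicalPhysics.QuantumManyBody.BoseGas.Config (m + 1) → ℝ := fun X => ‖Φ.ψ X‖ / Real.sqrt (W X); let β : Literature.MathematicalPhysics.QuantumManyBody.BoseGas.Config (m + 1) → ℂ := fun X => ∫ y in Literature.MathematicalPhysics.QuantumManyBody.BoseGas.cell L, Complex.exp (Complex.I * ↑(2 * Real.pi / L * ∑ j, (n j : ℝ) * y j)) * (ψ (Function.update X 0 y) : ℂ); let q : Literature.MathematicalPhysics.QuantumManyBody.BoseGas.Config (m + 1) → ℂ := fun X => ((Real.sqrt (L ^ 3))⁻¹ : ℂ) * (Complex.exp (Complex.I * ↑(2 * Real.pi / L * ∑ j, (n j : ℝ) * X 0 j)) * (ψ X : ℂ) - β X * (ψ X : ℂ) ^ 2); let ν : ℕ := (Finset.univ.sup fun j => (n j).natAbs) - 1; let s : ℝ := L / (ν + 1); let cube : (Fin 3 → Fin (ν + 1)) → Set Literature.MathematicalPhysics.QuantumManyBody.BoseGas.Space := fun Q => {y |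 ∀ l, y l ∈ Set.Ico (((Q l : ℕ) : ℝ) * s) ((((Q l : ℕ) : ℝ) + 1) * s)}; let idx : Literature.MathematicalPhysics.QuantumManyBody.BoseGas.Space → (Fin 3 → Fin (ν + 1)) := fun y l => ⟨min ν ⌊y l / s⌋₊, Nat.lt_succ_of_le (min_le_left _ _)⟩; let qc : Literature.MathematicalPhysics.QuantumManyBody.BoseGas.Config (m + 1) → ℂ := fun X => ((ψ X ^ 2 : ℝ) : ℂ) * ((∫ y in cube (idx (X 0)), q (Function.update X 0 y)) / ((∫ y in cube (idx (X 0)), ψ (Function.update X 0 y) ^ 2 : ℝ) : ℂ)); ∀ η : Literature.MathematicalPhysics.QuantumManyBody.BoseGas.Config (m + 1) → ℂ, (ContDiff ℝ 1 η ∧ ∀ (X : Literature.MathematicalPhysics.QuantumManyBody.BoseGas.Config (m + 1)) (i : Fin (m + 1)) (l : Fin 3), η (X + Pi.single i (EuclideanSpace.single l L)) = η X) → ENNReal.ofReal (‖(∫ X in Literature.MathematicalPhysics.QuantumManyBody.BoseGas.cellN (m + 1) L, q X * η X) - ∫ X in Literature.MathematicalPhysics.QuantumManyBody.BoseGas.cellN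 (m + 1) L, qc X * η X‖ ^ 2) ≤ ENNReal.ofReal (A * L ^ 2 / ‖(fun j => (n j : ℝ))‖ ^ 2) * ∫⁻ X in Literature.MathematicalPhysics.QuantumManyBody.BoseGas.cellN (m + 1) L, ENNReal.ofReal ((∑ l : Fin 3, ‖fderiv ℝ η X (Pi.single 0 (EuclideanSpace.single l (1 : ℝ)))‖ ^ 2) * (ψ X ^ 2 / W X))

/-- Child 2 (LANDSCAPE, coarse; conditional on child 3): the half-shell occupation input implies the
fibre dual bound `B L²/‖n‖²` of the coarse (block) part of the charge, for `‖n‖_∞ ≥ 2`. -/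
def CoarseBeatConductance : Prop :=
  (∀ v : ℝ → ENNReal, Literature.MathematicalPhysics.QuantumManyBody.BoseGas.IsRepulsiveFiniteRange v → (∃ B : ℝ, ∀ r, v r ≤ ENNReal.ofReal B) → ∀ M : ℝ, 0 < M → ∃ θ ρ₀ K : ℝ, 0 < θ ∧ 0 < ρ₀ ∧ 0 < K ∧ ∃ N₀ : ℕ, ∀ m : ℕ, N₀ ≤ m + 1 → ∀ L : ℝ, 0 < L → ((m + 1 : ℕ) : ℝ) ≤ ρ₀ * L ^ 3 → ∀ n : Fin 3 → ℤ, n ≠ 0 → 2 * Real.pi * ‖(fun j => (n j : ℝ))‖ / L ≤ M * Real.sqrt ((m + 1 : ℕ) / L ^ 3) → ∀ Φ : Literature.MathematicalPhysics.QuantumManyBody.BoseGas.PeriodicTrialState (m + 1) L, Literature.MathematicalPhysics.QuantumManyBody.BoseGas.periodicEnergy v Φ = Literature.MathematicalPhysics.QuantumManyBody.BoseGas.periodicGroundStateEnergy v (m + 1) L → (∀ X, Φ.ψ X ≠ 0) → ∀ p₁ : ℝ, 0 < p₁ → p₁ ≤ θ * Real.sqrt ((m + 1 : ℕ) / L ^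 3) * L / (2 * Real.pi) → p₁ ≤ ‖(fun j => (n j : ℝ))‖ / 2 → ∀ p : Fin 3 → ℤ, ‖(fun j => ((p j + n j : ℤ) : ℝ))‖ < p₁ → Literature.MathematicalPhysics.QuantumManyBody.BoseGas.cellOccupation (m + 1) L (Literature.MathematicalPhysics.QuantumManyBody.BoseGas.planeWaveMode L p) (fun X => (‖Φ.ψ X‖ : ℂ)) ≤ ENNReal.ofReal (K * (m + 1 : ℕ) / (‖(fun j => (n j : ℝ))‖ ^ 2 * p₁))) → ∀ v : ℝ → ENNReal, Literature.MathematicalPhysics.QuantumManyBody.BoseGas.IsRepulsiveFiniteRange v → (∃ B : ℝ, ∀ r, v r ≤ ENNReal.ofReal B) → ∀ M : ℝ, 0 < M → ∃ ρ₀ B : ℝ, 0 < ρ₀ ∧ 0 < B ∧ ∃ N₀ : ℕ, ∀ m : ℕ, N₀ ≤ m + 1 → ∀ L : ℝ, 0 < L → ((m + 1 : ℕ) : ℝ) ≤ ρ₀ * L ^ 3 → ∀ n : Fin 3 → ℤ, n ≠ 0 → 2 * Real.pi * ‖(fun j => (n j : ℝ))‖ / L ≤ M * Real.sqrt ((m +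 1 : ℕ) / L ^ 3) → ∀ Φ : Literature.MathematicalPhysics.QuantumManyBody.BoseGas.PeriodicTrialState (m + 1) L, Literature.MathematicalPhysics.QuantumManyBody.BoseGas.periodicEnergy v Φ = Literature.MathematicalPhysics.QuantumManyBody.BoseGas.periodicGroundStateEnergy v (m + 1) L → (∀ X, Φ.ψ X ≠ 0) → 2 ≤ (Finset.univ.sup fun j => (n j).natAbs) → let W : Literature.MathematicalPhysics.QuantumManyBody.BoseGas.Config (m + 1) → ℝ := fun X => ∫ y in Literature.MathematicalPhysics.QuantumManyBody.BoseGas.cell L, ‖Φ.ψ (Function.update X 0 y)‖ ^ 2; let ψ : Literature.MathematicalPhysics.QuantumManyBody.BoseGas.Config (m + 1) → ℝ := fun X => ‖Φ.ψ X‖ / Real.sqrt (W X); let β : Literature.MathematicalPhysics.QuantumManyBody.BoseGas.Config (m + 1) → ℂ := fun X => ∫ y in Literature.MathematicalPhysics.QuantumManyBody.BoseGas.cell L, Complex.exp (Complex.I * ↑(2 * Real.pi / L * ∑ j, (n j : ℝ) * y j)) * (ψ (Function.update X 0 y) : ℂ); let q : Literature.MathematicalPhysics.QuantumManyBody.BoseGas.Config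 (m + 1) → ℂ := fun X => ((Real.sqrt (L ^ 3))⁻¹ : ℂ) * (Complex.exp (Complex.I * ↑(2 * Real.pi / L * ∑ j, (n j : ℝ) * X 0 j)) * (ψ X : ℂ) - β X * (ψ X : ℂ) ^ 2); let ν : ℕ := (Finset.univ.sup fun j => (n j).natAbs) - 1; let s : ℝ := L / (ν + 1); let cube : (Fin 3 → Fin (ν + 1)) → Set Literature.MathematicalPhysics.QuantumManyBody.BoseGas.Space := fun Q => {y | ∀ l, y l ∈ Set.Ico (((Q l : ℕ) : ℝ) * s) ((((Q l : ℕ) : ℝ) + 1) * s)}; let idx : Literature.MathematicalPhysics.QuantumManyBody.BoseGas.Space → (Fin 3 → Fin (ν + 1)) := fun y l => ⟨min ν ⌊y l / s⌋₊, Nat.lt_succ_of_le (min_le_left _ _)⟩; let qc : Literature.MathematicalPhysics.QuantumManyBody.BoseGas.Config (m + 1) → ℂ := fun X => ((ψ X ^ 2 : ℝ) : ℂ) * ((∫ y in cube (idx (X 0)), q (Function.update X 0 y)) / ((∫ y in cube (idx (X 0)), ψ (Function.update X 0 y) ^ 2 : ℝ) : ℂ)); ∀ η : Literature.MathematicalPhysics.QuantumManyBody.BoseGas.Config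 (m + 1) → ℂ, (ContDiff ℝ 1 η ∧ ∀ (X : Literature.MathematicalPhysics.QuantumManyBody.BoseGas.Config (m + 1)) (i : Fin (m + 1)) (l : Fin 3), η (X + Pi.single i (EuclideanSpace.single l L)) = η X) → ENNReal.ofReal (‖∫ X in Literature.MathematicalPhysics.QuantumManyBody.BoseGas.cellN (m + 1) L, qc X * η X‖ ^ 2) ≤ ENNReal.ofReal (B * L ^ 2 / ‖(fun j => (n j : ℝ))‖ ^ 2) * ∫⁻ X in Literature.MathematicalPhysics.QuantumManyBody.BoseGas.cellN (m + 1) L, ENNReal.ofReal ((∑ l : Fin 3, ‖fderiv ℝ η X (Pi.single 0 (EuclideanSpace.single l (1 : ℝ)))‖ ^ 2) * (ψ X ^ 2 / W X))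

end Summit.AtomisticToContinuum.BoseEinsteinCondensation.Cruxes.FibreConductance.StrategistSplit.Children

/-! ## §B  The same statements over the landed vocabulary, and the readback by `Iff.rfl` -/

namespace Summit.AtomisticToContinuum.BoseEinsteinCondensation.Cruxes.FibreConductance.StrategistSplit

open MeasureTheory
open scoped ENNReal
open Literature.MathematicalPhysics.QuantumManyBody.BoseGas
open Summit.AtomisticToContinuum.BoseEinsteinCondensation.Theses.BECThomsonPrinciple (FibreConductance)
open Summit.AtomisticToContinuum.BoseEinsteinCondensation.Cruxes.FibreConductance.StrategistSplit.Children
  (HalfShellOccupation LocalFibreConductance CoarseBeatConductance)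
open Summit.AtomisticToContinuum.BoseEinsteinCondensation.Cruxes.FibreConductance.ParsevalShellBootstrap
open Summit.AtomisticToContinuum.BoseEinsteinCondensation.Cruxes.FibreConductance.HealingSplitKineticDefect
open Summit.AtomisticToContinuum.BoseEinsteinCondensation.Cruxes.FibreConductance.ConditionalLawPoincare

variable {m : ℕ} {L : ℝ}

/-- LOCAL DIFFERENCE BOUND (child 1 over the landed vocabulary): in the crux's window, for exact
zero-free minimisers, `‖∫qη − ∫q_cη‖² ≤ (A L²/‖n‖²)·E(η)` for every test `η`, `q_c` the coarse part of
the crux's charge on the wavelength tiling. [folklore] -/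
def LocalDiffBound : Prop :=
  LowDensityWindow fun m L n Φ A =>
    ∀ η : Config (m + 1) → ℂ, IsTest L η →
      ENNReal.ofReal (‖(∫ X in cellN (m + 1) L, cruxCharge n Φ X * η X) -
          ∫ X in cellN (m + 1) L, coarseOf L (waveBlocks n) Φ (cruxCharge n Φ) X * η X‖ ^ 2) ≤
        ENNReal.ofReal (A * L ^ 2 / ‖(fun j => (n j : ℝ))‖ ^ 2) * dualEnergy Φ η

/-- Readback: child 1 IS `LocalDiffBound`. [folklore] -/
theorem localFibreConductance_iff : LocalFibreConductance ↔ LocalDiffBound := Iff.rfl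

/-- Readback: child 3 IS the landed `ShellOccupation`. [folklore] -/
theorem halfShellOccupation_iff : HalfShellOccupation ↔ ShellOccupation := Iff.rfl

/-- Readback: child 2 IS `ShellOccupation → CoarseBeatDualBound`. [folklore] -/
theorem coarseBeatConductance_iff :
    CoarseBeatConductance ↔ (ShellOccupation → CoarseBeatDualBound) := Iff.rfl

/-! ## §C  The glue -/

/-- `ℝ≥0∞` bookkeeping: `2·ofReal(Au) + 2·ofReal(Bu) = ofReal((2A+2B)u)` for `A, B, u ≥ 0`. [folklore] -/
theorem two_ofReal_add_two_ofReal {A B u : ℝ} (hA : 0 ≤ A) (hB : 0 ≤ B) (hu : 0 ≤ u) :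
    2 * ENNReal.ofReal (A * u) + 2 * ENNReal.ofReal (B * u) = ENNReal.ofReal ((2 * A + 2 * B) * u) := by
  rw [← ENNReal.ofReal_ofNat 2, ← ENNReal.ofReal_mul (by norm_num), ← ENNReal.ofReal_mul (by norm_num),
    ← ENNReal.ofReal_add (by positivity) (by positivity)]
  congr 1
  ring

/-- `‖I‖² ≤ 2‖I − J‖² + 2‖J‖²` in `ℝ≥0∞`. [folklore] -/
theorem ofReal_norm_sq_le_of_sub (I J : ℂ) :
    ENNReal.ofReal (‖I‖ ^ 2) ≤ 2 * ENNReal.ofReal (‖I - J‖ ^ 2) + 2 * ENNReal.ofReal (‖J‖ ^ 2) := by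
  have h2 : (2 : ℝ≥0∞) = ENNReal.ofReal 2 := by norm_num
  rw [h2, ← ENNReal.ofReal_mul zero_le_two, ← ENNReal.ofReal_mul zero_le_two,
    ← ENNReal.ofReal_add (by positivity) (by positivity)]
  refine ENNReal.ofReal_le_ofReal ?_
  have e : I = (I - J) + J := (sub_add_cancel I J).symm
  have hn : ‖I‖ ≤ ‖I - J‖ + ‖J‖ := by
    calc ‖I‖ = ‖(I - J) + J‖ := by rw [← e]
      _ ≤ ‖I - J‖ + ‖J‖ := norm_add_le _ _
  nlinarith [hn, norm_nonneg I, norm_nonneg (I - J), norm_nonneg J, sq_nonneg (‖I - J‖ - ‖J‖)]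

/-- **The crux's dual bound from the local difference bound and the coarse beat dual bound**
(`ρ₀ = min`, `N₀ = max`, `C = 2A + 2B`; at `‖n‖_∞ = 1` the coarse charge vanishes identically by the
landed `bottomMode_neutral`). [folklore] -/
theorem cruxDualBound_of_local_coarse (hloc : LocalDiffBound) (hcb : CoarseBeatDualBound) :
    CruxDualBound := by
  intro v hv hbdd M hM
  obtain ⟨ρ₁, A, hρ₁, hA, N₁, h₁⟩ := hloc v hv hbdd M hM
  obtain ⟨ρ₂, B, hρ₂, hB, N₂, h₂⟩ := hcb v hv hbdd M hM
  refine ⟨min ρ₁ ρ₂, 2 * A + 2 * B, lt_min hρ₁ hρ₂, by positivity, max N₁ N₂, ?_⟩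
  intro m hm L hL hρ n hn hwin Φ hE hΦ η hη
  have hL3 : (0 : ℝ) ≤ L ^ 3 := by positivity
  have hρ₁' : ((m + 1 : ℕ) : ℝ) ≤ ρ₁ * L ^ 3 :=
    hρ.trans (mul_le_mul_of_nonneg_right (min_le_left _ _) hL3)
  have hρ₂' : ((m + 1 : ℕ) : ℝ) ≤ ρ₂ * L ^ 3 :=
    hρ.trans (mul_le_mul_of_nonneg_right (min_le_right _ _) hL3)
  have hu : 0 ≤ L ^ 2 / ‖(fun j => (n j : ℝ))‖ ^ 2 := by positivity
  set u : ℝ := L ^ 2 / ‖(fun j => (n j : ℝ))‖ ^ 2 with hu_def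
  set I : ℂ := ∫ X in cellN (m + 1) L, cruxCharge n Φ X * η X with hI
  set J : ℂ := ∫ X in cellN (m + 1) L, coarseOf L (waveBlocks n) Φ (cruxCharge n Φ) X * η X with hJ
  -- the local part
  have hlocal : ENNReal.ofReal (‖I - J‖ ^ 2) ≤ ENNReal.ofReal (A * u) * dualEnergy Φ η := by
    have h := h₁ m (le_of_max_le_left hm) L hL hρ₁' n hn hwin Φ hE hΦ η hη
    rwa [hu_def, ← mul_div_assoc]
  -- the coarse part: zero at the bottom modes, `hcb` above
  have hcoarse : ENNReal.ofReal (‖J‖ ^ 2) ≤ ENNReal.ofReal (B * u) * dualEnergy Φ η := by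
    rcases Nat.lt_or_ge (supIdx n) 2 with hlt | hge
    · have h1 : supIdx n = 1 := le_antisymm (Nat.lt_succ_iff.mp hlt) (one_le_supIdx hn)
      have hz : ∀ X, coarseOf L (waveBlocks n) Φ (cruxCharge n Φ) X = 0 := by
        rw [waveBlocks_eq_zero h1]
        exact coarseOf_cruxCharge_zero_eq_zero bottomMode_neutral hL n Φ hΦ
      have hJ0 : J = 0 := by
        rw [hJ]
        simp [hz]
      rw [hJ0]
      simp
    · have h := h₂ m (le_of_max_le_right hm) L hL hρ₂' n hn hwin Φ hE hΦ hge η hη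
      rwa [hu_def, ← mul_div_assoc]
  calc ENNReal.ofReal (‖I‖ ^ 2)
      ≤ 2 * ENNReal.ofReal (‖I - J‖ ^ 2) + 2 * ENNReal.ofReal (‖J‖ ^ 2) := ofReal_norm_sq_le_of_sub I J
    _ ≤ 2 * (ENNReal.ofReal (A * u) * dualEnergy Φ η) + 2 * (ENNReal.ofReal (B * u) * dualEnergy Φ η) := by
        gcongr
    _ = (2 * ENNReal.ofReal (A * u) + 2 * ENNReal.ofReal (B * u)) * dualEnergy Φ η := by ring
    _ = ENNReal.ofReal ((2 * A + 2 * B) * u) * dualEnergy Φ η := by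
        rw [two_ofReal_add_two_ofReal hA.le hB.le hu]
    _ = ENNReal.ofReal ((2 * A + 2 * B) * L ^ 2 / ‖(fun j => (n j : ℝ))‖ ^ 2) * dualEnergy Φ η := by
        rw [hu_def, mul_div_assoc]

/-- **The crux from the two named landscape statements and the infrared input** (landed vocabulary):
`LocalDiffBound → (ShellOccupation → CoarseBeatDualBound) → ShellOccupation → FibreConductance`. [folklore] -/
theorem fibreConductance_of_named (hloc : LocalDiffBound) (hcu : ShellOccupation → CoarseBeatDualBound)
    (hso : ShellOccupation) : FibreConductance :=
  fibreConductance_of_cruxDualBound (cruxDualBound_of_local_coarse hloc (hcu hso))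

/-- **STRATEGIST'S SPLIT of `FibreConductance` (stmt-AtomisticToContinuum-9480)**, concluding the crux
BY NAME from the three children as they appear in the route file:
`LocalFibreConductance → CoarseBeatConductance → HalfShellOccupation → FibreConductance`. [folklore] -/
theorem fibreConductance_of_subs :
    LocalFibreConductance → CoarseBeatConductance → HalfShellOccupation → FibreConductance :=
  fun h₁ h₂ h₃ => fibreConductance_of_named h₁ h₂ h₃

end Summit.AtomisticToContinuum.BoseEinsteinCondensation.Cruxes.FibreConductance.StrategistSplit

end
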